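import Summits.QuantumFields.YangMills.Theorems.UnitScaleTiltProp7OneFormKatoBootstrap
import Summits.QuantumFields.YangMills.Theorems.UnitScaleTiltProp7SectET3RealCoordSums
import HarnessLib

/-!
# Route `UnitScaleTilt`, crux K1 «MinimiserStabilityRegPr» (stmt-QuantumFields-19200), EX face S45 — (L3′b), ONE-FORM STOREY, (P-1FA) FILE A1:
# **THE FORM (GÅRDING) EDITION OF THE KATO DECOMPOSITION OF `Δ_a = Δx + D R_S D* + Q*aQ`, AND THE ABSTRACT AGMON BOUND WITH A GÅRDING PERTURBATION** —
# `re⟪A, Δ_aA⟫ = η⁻²Σ_μ‖D_{U₀}A_μ‖² + re⟪A, η⁻²(Δ′₁ − 𝒦)A⟫ + re⟪A,(Δx − Δ^η)A⟫ − ‖(1 − R_S)D*A‖² + a‖Q_kA‖²` ([Balaban1985Variational] (134)–(135) integrated against `A`), hence the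
# Kato energy is controlled by the form of `Δ_a` up to displayed bounded letters; and, abstractly, `T = D†D + V` with `V` bounded below in form, bounded conjugation defects
# of `D` and of `V`'s form, and coercivity `re⟪v,Tv⟫ ≥ γ‖v‖²` give `Θ·‖Mu‖ ≤ ‖M(Tu)‖` for every weight pair `(M, Mi)` — the (3.46)-class weighted bound

Cell `ym3-torus` (HUMAN RULING D-0037; rung R3 = SU(2) YM₃ on T³ — NOT d = 4, NOT infinite volume, NOT a mass gap, NOT Clay).  Chair seat ★`ym-ust-19200-p1` g26, own pen (P-1FA)
(CHAIR WORDS №4∕№5 [p1-g26]).  THEOREMS ONLY (0 `def`, 0 `sorry`, default heartbeats); `--supports stmt-QuantumFields-19200 --as helper`; count-neutral.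

WHY.  O2 (✓`Prop7OneFormKatoBootstrap`) bounds `sup|G f|` by `‖f‖_∞` and `‖u‖_{L²}` for block-supported `f`; the pointwise DECAY `e^{−δ·tdist}` that the rows `h133`∕`h137k•`∕`hCk` and the
row sums of `norm_G`∕`norm_H` need comes (V4's pattern) from a WEIGHTED `L²` bound `‖w·Gf‖ ≤ C‖w·f‖` — [Balaban1985BackgroundPropagators] (3.46)-class — by the Agmon∕Combes–Thomas
argument in H¹ currency (the (L3′a) road of ✓`Prop7MassivePropagatorAgmon` for the site operator `G_a`).  For the one-form operator the principal part is the Kato gradient energy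
`η⁻²Σ_μ‖D_{U₀}A_μ‖²` (O1∕O2: `Δ_a = η⁻²Δ¹_{U₀} + remainder`), and the remainder is bounded only IN FORM (`−‖(1−R_S)D*A‖² + a‖Q_kA‖²` plus an `O(ε₀)` local part) — so the
engine must be the Gårding edition: `T = D†D + V`, `re⟪v,Vv⟫ ≥ −C_V‖v‖²`.  This file proves that engine abstractly (§1, Mathlib algebra) and the member's form identity (§2) with the
two one-sided form letters (§3); the member's conjugation defects are FILE A2, the assembly FILE A3.
WHAT IS PROVED (ns `Summit.QuantumFields.YangMills.Theorems.Prop7OneFormGarding`).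
* §1 ★★★ `agmon_bound_of_garding` — inner-product spaces `E`, `G`; `D : E → G` with an adjoint `D†`; `T = D†D + V`; weights `M`, `Mi` on `E` (`Mi∘M = 1`, `M` symmetric) and `M′`, `M′i` on `G`
  (`⟪M′a, M′i b⟫ = ⟪a,b⟫`); conjugation defects `D∘M = M′∘(D + K₁)`, `D∘Mi = M′i∘(D + K₁′)` with `‖K₁‖, ‖K₁′‖ ≤ δ₁`; coercivity `γ‖v‖² ≤ re⟪v,Tv⟫`; `re⟪v,Vv⟫ ≥ −C_V‖v‖²`; and the form
  defect of `V`: `re⟪Mv, V(Mi v)⟫ ≥ re⟪v,Vv⟫ − θ_V‖v‖²`.  THEN for `Tu = f` and every `0 < ε ≤ 1`: `((1−ε)γ − εC_V − δ₁²(1 + 1∕ε) − θ_V)·‖Mu‖ ≤ ‖Mf‖`.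
* §2 `inner_sub_RS_eq_normSq` (`re⟪g, g − R_Sg⟫ = ‖g − R_Sg‖²`: `R_S` is an orthogonal projection, lit ✓`projR_isSymmetric`∕`projR_projR`); `sum_inner_toL2S_formComp` (the bond pairing is
  the sum of the three component pairings); ★★★ `re_inner_laplaceA_eq` — THE FORM IDENTITY above, for EVERY background, slot `Δx`, coupling `a` and bond field `X`
  (px5 g12 ✓`Prop7OneFormKatoForm.covLapSite_toL2S_formComp_eq` per component + ✓`inner_covLapSite` + ✓`adjoint_DL2` + `LinearMap.adjoint_inner_right`).
* §3 ★★ `katoEnergy_le` — `η⁻²Σ_μ‖D_{U₀}A_μ‖² ≤ re⟪A,Δ_aA⟫ + (C_loc + C_P)‖A‖² − a‖Q_kA‖² − re⟪A,(Δx−Δ^η)A⟫` from the displayed letters `hloc : |re⟪A, η⁻²(Δ′₁−𝒦)A⟫| ≤ C_loc‖A‖²`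
  (the `L²` edition of O1's local letter) and `hP : ‖(1−R_S)D*A‖² ≤ C_P‖A‖²` (★p1 g24 ✓`Prop7RTermFloor.normSq_adjoint_le_normSq_proj_add` under Lift: `C_P = 1∕(m_B²a)`);
  ★★ `re_inner_remainder_ge`∕`re_inner_remainder_le` — the two one-sided bounds of `V := Δ_a − η⁻²Δ¹_{U₀} − (Δx − Δ^η)` in form: `−(C_loc + C_P)‖A‖² ≤ re⟪A,VA⟫ ≤ (C_loc + a·C_Q²)‖A‖²`
  (`‖Q_kA‖ ≤ C_Q‖A‖`, routeR-w4 ✓`sum_normSq_entries_QTwS_le` class) — the `C_V` letter of §1 at the member.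
HONEST SCOPE.  Algebra + bookkeeping; the letters `hloc`, `hP`, `hQ` and the coercivity are displayed; nothing of the ten EX rows, `hT`, (3.46)∕Thm 3.12 for print's operators, EX or the
crux is proved here.

References: T. Bałaban, CMP **99** (1985) 389–434 [Balaban1985BackgroundPropagators] ((3.10)–(3.11) p.392, (3.21)–(3.26) pp.394–395, Thm 3.1 (3.46) p.398, Thm 3.12 p.422, p.421);
CMP **102** (1985) 277–309 [Balaban1985Variational] ((134)–(136) p.298); S. Agmon, *Lectures on exponential decay* (Princeton 1982) Ch. 1 [folklore].
-/

set_option autoImplicit false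

noncomputable section

open scoped Matrix.Norms.L2Operator BigOperators InnerProductSpace ComplexConjugate

namespace Summit.QuantumFields.YangMills.Theorems.Prop7OneFormGarding

open Literature.MathematicalPhysics.QuantumFieldTheory.Balaban1983to89
open Literature.MathematicalPhysics.QuantumFieldTheory.Balaban1983to89.T3ContinuumYM3Torus
open T3SectALandauChart (formComp bgUnits eta eta_pos)
open B9TorusCalculus (torusT)
open B9Eq310Hermitian (deltaPrimeOp)
open B11Eq135Weitzenbock (curvOp)
open B11Eq103H1Complex (SiteL2K BondL2K projR_isSymmetric projR_projR)
open Summit.QuantumFields.YangMills.Theorems.Prop7SectET3Transport (periodsT3 siteEquiv)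
open Summit.QuantumFields.YangMills.Theorems.Prop7SectET3HilbertLetters (W₂ toL2 toL2S DL2 DstarL2 covLapSite inner_toL2 adjoint_DL2 inner_covLapSite)
open Summit.QuantumFields.YangMills.Theorems.Prop7SectET3RealCoordSums (inner_toL2S)
open Summit.QuantumFields.YangMills.Theorems.Prop7SectET3WilsonHessian (DeltaEta)
open Summit.QuantumFields.YangMills.Theorems.Prop7SectET3GaugeProjector (RS RS_eq_projR)
open Summit.QuantumFields.YangMills.Theorems.Prop7SectET3CurvedPropagators (laplaceA Qk)
open Summit.QuantumFields.YangMills.Theorems.Prop7SectET3DeltaEtaExplicit (sum_pbond_eq)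
open Summit.QuantumFields.YangMills.Theorems.Prop7OneFormKatoForm (covLapSite_toL2S_formComp_eq)

/-! ## §1 The abstract Agmon bound with a Gårding perturbation -/

section Abstract

variable {E G : Type*} [NormedAddCommGroup E] [InnerProductSpace ℂ E] [NormedAddCommGroup G] [InnerProductSpace ℂ G]

/-- `re⟪x, y⟫ ≤ ‖x‖‖y‖`. [folklore] -/
theorem re_inner_le_norm_mul_norm' (x y : E) : RCLike.re ⟪x, y⟫_ℂ ≤ ‖x‖ * ‖y‖ :=
  (RCLike.re_le_norm _).trans (norm_inner_le_norm x y)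

/-- `−‖x‖‖y‖ ≤ re⟪x, y⟫`. [folklore] -/
theorem neg_norm_mul_norm_le_re_inner (x y : E) : -(‖x‖ * ‖y‖) ≤ RCLike.re ⟪x, y⟫_ℂ := by
  have h := re_inner_le_norm_mul_norm' x (-y)
  rw [inner_neg_right, map_neg, norm_neg] at h
  linarith

/-- ★★★ **THE AGMON BOUND FOR `T = D†D + V` (Gårding edition).**  `D : E → G` with adjoint `D†` (`⟪Dv, g⟫ = ⟪v, D†g⟫`), `T = D†D + V`; a weight `M` on `E` with inverse `Mi` (`Mi(Mv) = v`),
`M` symmetric (`⟪Mx, y⟫ = ⟪x, My⟫`), weights `M′`, `M′i` on `G` with `⟪M′a, M′i b⟫ = ⟪a, b⟫`; conjugation defects `D(Mv) = M′(Dv + K₁v)`, `D(Mi v) = M′i(Dv + K₁′v)`, `‖K₁v‖, ‖K₁′v‖ ≤ δ₁‖v‖`;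
coercivity `γ‖v‖² ≤ re⟪v, Tv⟫`; `V` bounded below in form `−C_V‖v‖² ≤ re⟪v, Vv⟫` and with form defect `re⟪v, Vv⟫ − θ_V‖v‖² ≤ re⟪Mv, V(Mi v)⟫`.  Then for `Tu = f` and `0 < ε ≤ 1`:
`((1 − ε)γ − εC_V − δ₁²(1 + 1∕ε) − θ_V)·‖Mu‖ ≤ ‖Mf‖` — the weighted `L²` bound (3.46)-class: `u` decays like the weight away from the support of `f`, at any rate for which the bracket is
positive. [cite: Balaban1985BackgroundPropagators, Thm 3.1 (3.46) p.398, Thm 3.12 p.422] -/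
theorem agmon_bound_of_garding
    (D : E →ₗ[ℂ] G) (Dad : G →ₗ[ℂ] E) (hDad : ∀ (v : E) (g : G), ⟪D v, g⟫_ℂ = ⟪v, Dad g⟫_ℂ)
    (T V : E →ₗ[ℂ] E) (hT : ∀ v, T v = Dad (D v) + V v)
    (M Mi : E →ₗ[ℂ] E) (M' M'i : G →ₗ[ℂ] G) (hMiM : ∀ v, Mi (M v) = v)
    (hMsa : ∀ x y : E, ⟪M x, y⟫_ℂ = ⟪x, M y⟫_ℂ) (hpair : ∀ a b : G, ⟪M' a, M'i b⟫_ℂ = ⟪a, b⟫_ℂ)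
    (K₁ K₁' : E →ₗ[ℂ] G) (hK₁ : ∀ v, D (M v) = M' (D v + K₁ v)) (hK₁' : ∀ v, D (Mi v) = M'i (D v + K₁' v))
    {γ CV δ₁ θV ε : ℝ} (hδ₁ : 0 ≤ δ₁) (hε : 0 < ε) (hε1 : ε ≤ 1)
    (hco : ∀ v, γ * ‖v‖ ^ 2 ≤ RCLike.re ⟪v, T v⟫_ℂ)
    (hVlow : ∀ v, -(CV * ‖v‖ ^ 2) ≤ RCLike.re ⟪v, V v⟫_ℂ)
    (bK₁ : ∀ v, ‖K₁ v‖ ≤ δ₁ * ‖v‖) (bK₁' : ∀ v, ‖K₁' v‖ ≤ δ₁ * ‖v‖)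
    (hVconj : ∀ v, RCLike.re ⟪v, V v⟫_ℂ - θV * ‖v‖ ^ 2 ≤ RCLike.re ⟪M v, V (Mi v)⟫_ℂ)
    (u f : E) (hu : T u = f) :
    ((1 - ε) * γ - ε * CV - δ₁ ^ 2 * (1 + 1 / ε) - θV) * ‖M u‖ ≤ ‖M f‖ := by
  set w : E := M u with hw
  have huw : u = Mi w := by rw [hw, hMiM]
  -- the conjugated identity `⟪w, Mf⟫ = ⟪Dw + K₁w, Dw + K₁′w⟫ + ⟪Mw, V(Mi w)⟫`
  have key : ⟪w, M f⟫_ℂ = ⟪D w + K₁ w, D w + K₁' w⟫_ℂ + ⟪M w, V (Mi w)⟫_ℂ := by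
    rw [← hMsa, ← hu, hT, inner_add_right, ← hDad, hK₁ w, huw, hK₁' w, hpair, ← huw]
  -- the energy identity `re⟪w, Tw⟫ = ‖Dw‖² + re⟪w, Vw⟫`
  have hTw : RCLike.re ⟪w, T w⟫_ℂ = ‖D w‖ ^ 2 + RCLike.re ⟪w, V w⟫_ℂ := by
    rw [hT, inner_add_right, map_add, ← hDad, inner_self_eq_norm_sq]
  -- real parts
  have hre : RCLike.re ⟪D w + K₁ w, D w + K₁' w⟫_ℂ
      = ‖D w‖ ^ 2 + RCLike.re ⟪D w, K₁' w⟫_ℂ + RCLike.re ⟪K₁ w, D w⟫_ℂ + RCLike.re ⟪K₁ w, K₁' w⟫_ℂ := by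
    rw [inner_add_left, inner_add_right, inner_add_right, map_add, map_add, map_add, inner_self_eq_norm_sq]; ring
  have h1 : -(‖D w‖ * (δ₁ * ‖w‖)) ≤ RCLike.re ⟪D w, K₁' w⟫_ℂ :=
    (neg_le_neg (mul_le_mul_of_nonneg_left (bK₁' w) (norm_nonneg _))).trans (neg_norm_mul_norm_le_re_inner _ _)
  have h2 : -(δ₁ * ‖w‖ * ‖D w‖) ≤ RCLike.re ⟪K₁ w, D w⟫_ℂ :=
    (neg_le_neg (mul_le_mul_of_nonneg_right (bK₁ w) (norm_nonneg _))).trans (neg_norm_mul_norm_le_re_inner _ _)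
  have h3 : -(δ₁ * ‖w‖ * (δ₁ * ‖w‖)) ≤ RCLike.re ⟪K₁ w, K₁' w⟫_ℂ :=
    (neg_le_neg (mul_le_mul (bK₁ w) (bK₁' w) (norm_nonneg _) (by positivity))).trans (neg_norm_mul_norm_le_re_inner _ _)
  -- AM–GM: `2δ₁‖w‖‖Dw‖ ≤ ε‖Dw‖² + (δ₁²∕ε)‖w‖²`
  have hamgm : 2 * (δ₁ * ‖w‖ * ‖D w‖) ≤ ε * ‖D w‖ ^ 2 + δ₁ ^ 2 / ε * ‖w‖ ^ 2 := by
    have e2 : ε * ‖D w‖ ^ 2 + δ₁ ^ 2 / ε * ‖w‖ ^ 2 - 2 * (δ₁ * ‖w‖ * ‖D w‖) = (ε * ‖D w‖ - δ₁ * ‖w‖) ^ 2 / ε := by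
      field_simp
      ring
    rw [← sub_nonneg, e2]
    positivity
  -- assemble the lower bound `re⟪w, Mf⟫ ≥ Θ‖w‖²`
  have hlow : ((1 - ε) * γ - ε * CV - δ₁ ^ 2 * (1 + 1 / ε) - θV) * ‖w‖ ^ 2 ≤ RCLike.re ⟪w, M f⟫_ℂ := by
    rw [key, map_add, hre]
    have hc := hco w
    have hv := hVlow w
    have hcj := hVconj w
    rw [hTw] at hc
    have hc' : (1 - ε) * (γ * ‖w‖ ^ 2) ≤ (1 - ε) * (‖D w‖ ^ 2 + RCLike.re ⟪w, V w⟫_ℂ) := mul_le_mul_of_nonneg_left hc (by linarith)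
    have hv' : ε * (-(CV * ‖w‖ ^ 2)) ≤ ε * RCLike.re ⟪w, V w⟫_ℂ := mul_le_mul_of_nonneg_left hv hε.le
    have e1 : δ₁ ^ 2 * (1 + 1 / ε) * ‖w‖ ^ 2 = δ₁ * ‖w‖ * (δ₁ * ‖w‖) + δ₁ ^ 2 / ε * ‖w‖ ^ 2 := by ring
    have e2 : ‖D w‖ * (δ₁ * ‖w‖) = δ₁ * ‖w‖ * ‖D w‖ := by ring
    linarith [hcj, h1, h2, h3, hamgm, e1, e2, hc', hv']
  -- and the upper bound `re⟪w, Mf⟫ ≤ ‖w‖‖Mf‖`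
  have hup : RCLike.re ⟪w, M f⟫_ℂ ≤ ‖w‖ * ‖M f‖ := re_inner_le_norm_mul_norm' _ _
  by_cases hw0 : ‖w‖ = 0
  · rw [hw0, mul_zero]; exact norm_nonneg _
  · have hwpos : 0 < ‖w‖ := lt_of_le_of_ne (norm_nonneg _) (Ne.symm hw0)
    have := hlow.trans hup
    nlinarith [this, hwpos, norm_nonneg (M f)]

end Abstract

/-! ## §2 The form identity of `Δ_a` at the member -/

variable {F : T3Family} {n K : ℕ} {c₀ : ℝ} [Fact (0 < c₀)] {h : n ≤ K} {cB a : ℝ} [Fact (0 < cB)]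
  {Δx : GaugeField (F.P K) 0 (Matrix.specialUnitaryGroup (Fin 2) ℂ) → (BondL2K ℂ 3 (periodsT3 F K) c₀ W₂ →ₗ[ℂ] BondL2K ℂ 3 (periodsT3 F K) c₀ W₂)}

omit [Fact (0 < cB)] in
/-- **`R_S` is an orthogonal projection, so `⟪g, g − R_Sg⟫ = ‖g − R_Sg‖²`** (lit ✓`projR_isSymmetric`, ✓`projR_projR` through ✓`RS_eq_projR`). [cite: Balaban1985BackgroundPropagators, (3.21) p.394] -/
theorem inner_sub_RS_eq_normSq (U₀ : GaugeField (F.P K) 0 (Matrix.specialUnitaryGroup (Fin 2) ℂ)) (g : SiteL2K ℂ 3 (periodsT3 F K) c₀ W₂) :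
    ⟪g, g - RS F n K h c₀ cB U₀ g⟫_ℂ = ((‖g - RS F n K h c₀ cB U₀ g‖ : ℝ) : ℂ) ^ 2 := by
  have hsymm : (RS F n K h c₀ cB U₀).IsSymmetric := by rw [RS_eq_projR]; exact projR_isSymmetric _ _
  have hidem : ∀ x, RS F n K h c₀ cB U₀ (RS F n K h c₀ cB U₀ x) = RS F n K h c₀ cB U₀ x := fun x => by
    rw [RS_eq_projR]; exact projR_projR _ _ x
  -- `⟪Rg, g − Rg⟫ = ⟪g, R(g − Rg)⟫ = ⟪g, Rg − Rg⟫ = 0`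
  have h0 : ⟪RS F n K h c₀ cB U₀ g, g - RS F n K h c₀ cB U₀ g⟫_ℂ = 0 := by
    rw [hsymm, map_sub, hidem, sub_self, inner_zero_right]
  have hsplit : ⟪g, g - RS F n K h c₀ cB U₀ g⟫_ℂ = ⟪g - RS F n K h c₀ cB U₀ g, g - RS F n K h c₀ cB U₀ g⟫_ℂ + ⟪RS F n K h c₀ cB U₀ g, g - RS F n K h c₀ cB U₀ g⟫_ℂ := by
    rw [← inner_add_left, sub_add_cancel]
  rw [hsplit, h0, add_zero, inner_self_eq_norm_sq_to_K]
  rfl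

omit [Fact (0 < cB)] in
/-- The bond pairing is the sum of the three component pairings: `Σ_μ ⟪toL2S X_μ, toL2S Y_μ⟫ = ⟪toL2 X, toL2 Y⟫` (✓`inner_toL2S`, ✓`inner_toL2`, ✓`sum_pbond_eq`).
[cite: Balaban1985BackgroundPropagators, (3.11) p.392] -/
theorem sum_inner_toL2S_formComp (X Y : PBond (F.P K) 0 → Matrix (Fin 2) (Fin 2) ℂ) :
    ∑ μ : Fin (F.P K).d, ⟪toL2S F K c₀ (formComp X μ), toL2S F K c₀ (formComp Y μ)⟫_ℂ = ⟪toL2 F K c₀ X, toL2 F K c₀ Y⟫_ℂ := by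
  simp only [inner_toL2S, inner_toL2, ← Finset.mul_sum]
  congr 1
  rw [sum_pbond_eq, Finset.sum_comm]
  rfl

/-- ★★★ **THE FORM IDENTITY OF `Δ_a`** ([Balaban1985Variational] (134)–(135) integrated against the field): for EVERY background `U₀`, slot `Δx`, coupling `a` and bond field `X`, with
`v := toL2 X`:
`⟪v, Δ_a v⟫ = Σ_μ ‖D_{U₀}(toL2S X_μ)‖² + ⟪v, toL2(η⁻²(Δ′₁ − 𝒦)X)⟫ + ⟪v, (Δx − Δ^η)v⟫ − ‖D*v − R_S D*v‖² + a‖Q_k v‖²`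
— the Kato energy (the `η⁻²` sits inside `D_{U₀}`), the local form, the slot letter, the complementary-projector form (NEGATIVE), the averaging penalty.  (px5 g12 ✓`covLapSite_toL2S_formComp_eq` per
component + ✓`inner_covLapSite` + `inner_sub_RS_eq_normSq` + `LinearMap.adjoint_inner_right`.) [cite: Balaban1985Variational, (134)–(135) p.298; Balaban1985BackgroundPropagators, (3.26) p.395, (3.23) p.394] -/
theorem inner_laplaceA_eq (U₀ : GaugeField (F.P K) 0 (Matrix.specialUnitaryGroup (Fin 2) ℂ)) (X : PBond (F.P K) 0 → Matrix (Fin 2) (Fin 2) ℂ) :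
    ⟪toL2 F K c₀ X, laplaceA F n K h c₀ cB a Δx U₀ (toL2 F K c₀ X)⟫_ℂ
      = (∑ μ : Fin (F.P K).d, ((‖DL2 F n K c₀ U₀ (toL2S F K c₀ (formComp X μ))‖ : ℝ) : ℂ) ^ 2)
        + ⟪toL2 F K c₀ X, toL2 F K c₀ (fun b : PBond (F.P K) 0 => (eta F n K)⁻¹ • (eta F n K)⁻¹ •
            (deltaPrimeOp (torusT (F.P K) 0) (fun μ x => bgUnits F K U₀ ⟨x, μ⟩) 1 (formComp X) b.dir b.src
              - curvOp (torusT (F.P K) 0) (fun μ x => bgUnits F K U₀ ⟨x, μ⟩) (formComp X) b.dir b.src))⟫_ℂ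
        + ⟪toL2 F K c₀ X, (Δx U₀ - (DeltaEta F n K c₀ U₀ : BondL2K ℂ 3 (periodsT3 F K) c₀ W₂ →ₗ[ℂ] BondL2K ℂ 3 (periodsT3 F K) c₀ W₂)) (toL2 F K c₀ X)⟫_ℂ
        - ((‖DstarL2 F n K c₀ U₀ (toL2 F K c₀ X) - RS F n K h c₀ cB U₀ (DstarL2 F n K c₀ U₀ (toL2 F K c₀ X))‖ : ℝ) : ℂ) ^ 2
        + ((a : ℝ) : ℂ) * ((‖Qk F n K h c₀ cB U₀ (toL2 F K c₀ X)‖ : ℝ) : ℂ) ^ 2 := by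
  set v := toL2 F K c₀ X with hv
  set Y : PBond (F.P K) 0 → Matrix (Fin 2) (Fin 2) ℂ := (toL2 F K c₀).symm (laplaceA F n K h c₀ cB a Δx U₀ v) with hY
  have hXY : laplaceA F n K h c₀ cB a Δx U₀ (toL2 F K c₀ X) = toL2 F K c₀ Y := by rw [hY, LinearEquiv.apply_symm_apply]
  -- the pairing with `Y` through the components
  have hlhs : ⟪v, laplaceA F n K h c₀ cB a Δx U₀ v⟫_ℂ = ∑ μ : Fin (F.P K).d, ⟪toL2S F K c₀ (formComp X μ), toL2S F K c₀ (formComp Y μ)⟫_ℂ := by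
    rw [sum_inner_toL2S_formComp, ← hXY]
  -- per component: `⟪X_μ, Δ_{U₀}X_μ⟫ = ⟪X_μ, Y_μ⟫ − ⟪X_μ, q_μ⟫`, `⟪X_μ, Δ_{U₀}X_μ⟫ = ‖D X_μ‖²`
  have hcomp : ∀ μ : Fin (F.P K).d, ⟪toL2S F K c₀ (formComp X μ), toL2S F K c₀ (formComp Y μ)⟫_ℂ
      = ((‖DL2 F n K c₀ U₀ (toL2S F K c₀ (formComp X μ))‖ : ℝ) : ℂ) ^ 2
        + ⟪toL2S F K c₀ (formComp X μ), toL2S F K c₀ (fun x : Site (F.P K) 0 =>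
            (eta F n K)⁻¹ • (eta F n K)⁻¹ •
              (deltaPrimeOp (torusT (F.P K) 0) (fun μ x => bgUnits F K U₀ ⟨x, μ⟩) 1 (formComp X) μ x
                - curvOp (torusT (F.P K) 0) (fun μ x => bgUnits F K U₀ ⟨x, μ⟩) (formComp X) μ x)
            + (toL2 F K c₀).symm ((Δx U₀ - (DeltaEta F n K c₀ U₀ : BondL2K ℂ 3 (periodsT3 F K) c₀ W₂ →ₗ[ℂ] BondL2K ℂ 3 (periodsT3 F K) c₀ W₂)) (toL2 F K c₀ X)) ⟨x, μ⟩
            - (toL2 F K c₀).symm (DL2 F n K c₀ U₀ (DstarL2 F n K c₀ U₀ (toL2 F K c₀ X) - RS F n K h c₀ cB U₀ (DstarL2 F n K c₀ U₀ (toL2 F K c₀ X)))) ⟨x, μ⟩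
            + (toL2 F K c₀).symm (LinearMap.adjoint (Qk F n K h c₀ cB U₀) (((a : ℝ) : ℂ) • Qk F n K h c₀ cB U₀ (toL2 F K c₀ X))) ⟨x, μ⟩)⟫_ℂ := by
    intro μ
    have hc := covLapSite_toL2S_formComp_eq (F := F) (h := h) (c₀ := c₀) (cB := cB) (a := a) (Δx := Δx) (U₀ := U₀) X Y hXY μ
    rw [← inner_covLapSite, hc, inner_sub_right, sub_add_cancel]
  -- the four remainder pairings summed over the components are bond pairings
  have hsumq : ∑ μ : Fin (F.P K).d, ⟪toL2S F K c₀ (formComp X μ), toL2S F K c₀ (fun x : Site (F.P K) 0 =>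
            (eta F n K)⁻¹ • (eta F n K)⁻¹ •
              (deltaPrimeOp (torusT (F.P K) 0) (fun μ x => bgUnits F K U₀ ⟨x, μ⟩) 1 (formComp X) μ x
                - curvOp (torusT (F.P K) 0) (fun μ x => bgUnits F K U₀ ⟨x, μ⟩) (formComp X) μ x)
            + (toL2 F K c₀).symm ((Δx U₀ - (DeltaEta F n K c₀ U₀ : BondL2K ℂ 3 (periodsT3 F K) c₀ W₂ →ₗ[ℂ] BondL2K ℂ 3 (periodsT3 F K) c₀ W₂)) (toL2 F K c₀ X)) ⟨x, μ⟩
            - (toL2 F K c₀).symm (DL2 F n K c₀ U₀ (DstarL2 F n K c₀ U₀ (toL2 F K c₀ X) - RS F n K h c₀ cB U₀ (DstarL2 F n K c₀ U₀ (toL2 F K c₀ X)))) ⟨x, μ⟩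
            + (toL2 F K c₀).symm (LinearMap.adjoint (Qk F n K h c₀ cB U₀) (((a : ℝ) : ℂ) • Qk F n K h c₀ cB U₀ (toL2 F K c₀ X))) ⟨x, μ⟩)⟫_ℂ
      = ⟪v, toL2 F K c₀ (fun b : PBond (F.P K) 0 => (eta F n K)⁻¹ • (eta F n K)⁻¹ •
            (deltaPrimeOp (torusT (F.P K) 0) (fun μ x => bgUnits F K U₀ ⟨x, μ⟩) 1 (formComp X) b.dir b.src
              - curvOp (torusT (F.P K) 0) (fun μ x => bgUnits F K U₀ ⟨x, μ⟩) (formComp X) b.dir b.src))⟫_ℂ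
        + ⟪v, (Δx U₀ - (DeltaEta F n K c₀ U₀ : BondL2K ℂ 3 (periodsT3 F K) c₀ W₂ →ₗ[ℂ] BondL2K ℂ 3 (periodsT3 F K) c₀ W₂)) v⟫_ℂ
        - ⟪v, DL2 F n K c₀ U₀ (DstarL2 F n K c₀ U₀ v - RS F n K h c₀ cB U₀ (DstarL2 F n K c₀ U₀ v))⟫_ℂ
        + ⟪v, LinearMap.adjoint (Qk F n K h c₀ cB U₀) (((a : ℝ) : ℂ) • Qk F n K h c₀ cB U₀ v)⟫_ℂ := by
    have e : ∀ (g₁ g₂ g₃ : BondL2K ℂ 3 (periodsT3 F K) c₀ W₂) (W : PBond (F.P K) 0 → Matrix (Fin 2) (Fin 2) ℂ),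
        (fun b : PBond (F.P K) 0 => W b + (toL2 F K c₀).symm g₁ b - (toL2 F K c₀).symm g₂ b + (toL2 F K c₀).symm g₃ b)
          = (toL2 F K c₀).symm (toL2 F K c₀ W + g₁ - g₂ + g₃) := by
      intro g₁ g₂ g₃ W
      funext b
      simp only [map_add, map_sub, LinearEquiv.symm_apply_apply, Pi.add_apply, Pi.sub_apply]
    have hμ : ∀ μ : Fin (F.P K).d, (fun x : Site (F.P K) 0 =>
            (eta F n K)⁻¹ • (eta F n K)⁻¹ •
              (deltaPrimeOp (torusT (F.P K) 0) (fun μ x => bgUnits F K U₀ ⟨x, μ⟩) 1 (formComp X) μ x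
                - curvOp (torusT (F.P K) 0) (fun μ x => bgUnits F K U₀ ⟨x, μ⟩) (formComp X) μ x)
            + (toL2 F K c₀).symm ((Δx U₀ - (DeltaEta F n K c₀ U₀ : BondL2K ℂ 3 (periodsT3 F K) c₀ W₂ →ₗ[ℂ] BondL2K ℂ 3 (periodsT3 F K) c₀ W₂)) (toL2 F K c₀ X)) ⟨x, μ⟩
            - (toL2 F K c₀).symm (DL2 F n K c₀ U₀ (DstarL2 F n K c₀ U₀ (toL2 F K c₀ X) - RS F n K h c₀ cB U₀ (DstarL2 F n K c₀ U₀ (toL2 F K c₀ X)))) ⟨x, μ⟩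
            + (toL2 F K c₀).symm (LinearMap.adjoint (Qk F n K h c₀ cB U₀) (((a : ℝ) : ℂ) • Qk F n K h c₀ cB U₀ (toL2 F K c₀ X))) ⟨x, μ⟩)
        = formComp ((toL2 F K c₀).symm (toL2 F K c₀ (fun b : PBond (F.P K) 0 => (eta F n K)⁻¹ • (eta F n K)⁻¹ •
            (deltaPrimeOp (torusT (F.P K) 0) (fun μ x => bgUnits F K U₀ ⟨x, μ⟩) 1 (formComp X) b.dir b.src
              - curvOp (torusT (F.P K) 0) (fun μ x => bgUnits F K U₀ ⟨x, μ⟩) (formComp X) b.dir b.src))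
            + (Δx U₀ - (DeltaEta F n K c₀ U₀ : BondL2K ℂ 3 (periodsT3 F K) c₀ W₂ →ₗ[ℂ] BondL2K ℂ 3 (periodsT3 F K) c₀ W₂)) v
            - DL2 F n K c₀ U₀ (DstarL2 F n K c₀ U₀ v - RS F n K h c₀ cB U₀ (DstarL2 F n K c₀ U₀ v))
            + LinearMap.adjoint (Qk F n K h c₀ cB U₀) (((a : ℝ) : ℂ) • Qk F n K h c₀ cB U₀ v))) μ := by
      intro μ
      funext x
      simp only [formComp, map_add, map_sub, LinearEquiv.symm_apply_apply, Pi.add_apply, Pi.sub_apply, hv]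
    simp only [hμ]
    rw [sum_inner_toL2S_formComp, LinearEquiv.apply_symm_apply, inner_add_right, inner_sub_right, inner_add_right]
  -- the projector and penalty pairings
  have hD : ⟪v, DL2 F n K c₀ U₀ (DstarL2 F n K c₀ U₀ v - RS F n K h c₀ cB U₀ (DstarL2 F n K c₀ U₀ v))⟫_ℂ
      = ((‖DstarL2 F n K c₀ U₀ v - RS F n K h c₀ cB U₀ (DstarL2 F n K c₀ U₀ v)‖ : ℝ) : ℂ) ^ 2 := by
    rw [← adjoint_DL2, ← LinearMap.adjoint_inner_left, adjoint_DL2]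
    exact inner_sub_RS_eq_normSq U₀ _
  have hQ : ⟪v, LinearMap.adjoint (Qk F n K h c₀ cB U₀) (((a : ℝ) : ℂ) • Qk F n K h c₀ cB U₀ v)⟫_ℂ
      = ((a : ℝ) : ℂ) * ((‖Qk F n K h c₀ cB U₀ v‖ : ℝ) : ℂ) ^ 2 := by
    rw [LinearMap.adjoint_inner_right, inner_smul_right, inner_self_eq_norm_sq_to_K]
    rfl
  rw [hlhs, Finset.sum_congr rfl fun μ _ => hcomp μ, Finset.sum_add_distrib, hsumq, hD, hQ]
  abel

/-! ## §3 The Kato energy under the form of `Δ_a`, and the two one-sided letters of the remainder -/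

/-- ★★ **THE GÅRDING LETTER**: with the displayed `L²` bounds `hloc : |re⟪v, toL2(η⁻²(Δ′₁−𝒦)X)⟫| ≤ C_loc‖v‖²` (the form edition of O1's local letter) and `hP : ‖D*v − R_SD*v‖² ≤ C_P‖v‖²`
(★p1 g24 ✓`Prop7RTermFloor` under Lift, `C_P = 1∕(m_B²a)`), the Kato energy is controlled by the form of `Δ_a`:
`Σ_μ ‖D_{U₀}(toL2S X_μ)‖² ≤ re⟪v, Δ_av⟫ − re⟪v, (Δx−Δ^η)v⟫ − a‖Q_kv‖² + (C_loc + C_P)‖v‖²`. [cite: Balaban1985Variational, (134)–(136) p.298; Balaban1985BackgroundPropagators, (3.26) p.395] -/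
theorem katoEnergy_le (U₀ : GaugeField (F.P K) 0 (Matrix.specialUnitaryGroup (Fin 2) ℂ)) (X : PBond (F.P K) 0 → Matrix (Fin 2) (Fin 2) ℂ)
    {Cloc CP : ℝ}
    (hloc : |RCLike.re ⟪toL2 F K c₀ X, toL2 F K c₀ (fun b : PBond (F.P K) 0 => (eta F n K)⁻¹ • (eta F n K)⁻¹ •
            (deltaPrimeOp (torusT (F.P K) 0) (fun μ x => bgUnits F K U₀ ⟨x, μ⟩) 1 (formComp X) b.dir b.src
              - curvOp (torusT (F.P K) 0) (fun μ x => bgUnits F K U₀ ⟨x, μ⟩) (formComp X) b.dir b.src))⟫_ℂ| ≤ Cloc * ‖toL2 F K c₀ X‖ ^ 2)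
    (hP : ‖DstarL2 F n K c₀ U₀ (toL2 F K c₀ X) - RS F n K h c₀ cB U₀ (DstarL2 F n K c₀ U₀ (toL2 F K c₀ X))‖ ^ 2 ≤ CP * ‖toL2 F K c₀ X‖ ^ 2) :
    ∑ μ : Fin (F.P K).d, ‖DL2 F n K c₀ U₀ (toL2S F K c₀ (formComp X μ))‖ ^ 2
      ≤ RCLike.re ⟪toL2 F K c₀ X, laplaceA F n K h c₀ cB a Δx U₀ (toL2 F K c₀ X)⟫_ℂ
        - RCLike.re ⟪toL2 F K c₀ X, (Δx U₀ - (DeltaEta F n K c₀ U₀ : BondL2K ℂ 3 (periodsT3 F K) c₀ W₂ →ₗ[ℂ] BondL2K ℂ 3 (periodsT3 F K) c₀ W₂)) (toL2 F K c₀ X)⟫_ℂ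
        - a * ‖Qk F n K h c₀ cB U₀ (toL2 F K c₀ X)‖ ^ 2 + (Cloc + CP) * ‖toL2 F K c₀ X‖ ^ 2 := by
  have hid := congrArg RCLike.re (inner_laplaceA_eq (h := h) (cB := cB) (a := a) (Δx := Δx) U₀ X)
  simp only [map_add, map_sub] at hid
  have hsum : RCLike.re (∑ μ : Fin (F.P K).d, ((‖DL2 F n K c₀ U₀ (toL2S F K c₀ (formComp X μ))‖ : ℝ) : ℂ) ^ 2)
      = ∑ μ : Fin (F.P K).d, ‖DL2 F n K c₀ U₀ (toL2S F K c₀ (formComp X μ))‖ ^ 2 := by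
    rw [map_sum]
    refine Finset.sum_congr rfl fun μ _ => ?_
    norm_cast
  have hre1 : RCLike.re ((((‖DstarL2 F n K c₀ U₀ (toL2 F K c₀ X) - RS F n K h c₀ cB U₀ (DstarL2 F n K c₀ U₀ (toL2 F K c₀ X))‖ : ℝ) : ℂ) ^ 2))
      = ‖DstarL2 F n K c₀ U₀ (toL2 F K c₀ X) - RS F n K h c₀ cB U₀ (DstarL2 F n K c₀ U₀ (toL2 F K c₀ X))‖ ^ 2 := by norm_cast
  have hre2 : RCLike.re ((((a : ℝ) : ℂ)) * (((‖Qk F n K h c₀ cB U₀ (toL2 F K c₀ X)‖ : ℝ) : ℂ) ^ 2)) = a * ‖Qk F n K h c₀ cB U₀ (toL2 F K c₀ X)‖ ^ 2 := by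
    norm_cast
  rw [hsum, hre1, hre2] at hid
  have hl := (abs_le.mp hloc).1
  linarith

/-- ★★ **THE REMAINDER IS BOUNDED BELOW IN FORM** (the `C_V` letter of `agmon_bound_of_garding`): with `V := Δ_a − (Kato part) − (Δx − Δ^η)` in form,
`re⟪v, toL2(η⁻²(Δ′₁−𝒦)X)⟫ − ‖D*v − R_SD*v‖² + a‖Q_kv‖² ≥ −(C_loc + C_P)‖v‖²` for `a ≥ 0`. [cite: Balaban1985Variational, (134)–(136) p.298] -/
theorem re_remainder_ge (U₀ : GaugeField (F.P K) 0 (Matrix.specialUnitaryGroup (Fin 2) ℂ)) (X : PBond (F.P K) 0 → Matrix (Fin 2) (Fin 2) ℂ)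
    (ha : 0 ≤ a) {Cloc CP : ℝ}
    (hloc : |RCLike.re ⟪toL2 F K c₀ X, toL2 F K c₀ (fun b : PBond (F.P K) 0 => (eta F n K)⁻¹ • (eta F n K)⁻¹ •
            (deltaPrimeOp (torusT (F.P K) 0) (fun μ x => bgUnits F K U₀ ⟨x, μ⟩) 1 (formComp X) b.dir b.src
              - curvOp (torusT (F.P K) 0) (fun μ x => bgUnits F K U₀ ⟨x, μ⟩) (formComp X) b.dir b.src))⟫_ℂ| ≤ Cloc * ‖toL2 F K c₀ X‖ ^ 2)
    (hP : ‖DstarL2 F n K c₀ U₀ (toL2 F K c₀ X) - RS F n K h c₀ cB U₀ (DstarL2 F n K c₀ U₀ (toL2 F K c₀ X))‖ ^ 2 ≤ CP * ‖toL2 F K c₀ X‖ ^ 2) :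
    -((Cloc + CP) * ‖toL2 F K c₀ X‖ ^ 2)
      ≤ RCLike.re ⟪toL2 F K c₀ X, toL2 F K c₀ (fun b : PBond (F.P K) 0 => (eta F n K)⁻¹ • (eta F n K)⁻¹ •
            (deltaPrimeOp (torusT (F.P K) 0) (fun μ x => bgUnits F K U₀ ⟨x, μ⟩) 1 (formComp X) b.dir b.src
              - curvOp (torusT (F.P K) 0) (fun μ x => bgUnits F K U₀ ⟨x, μ⟩) (formComp X) b.dir b.src))⟫_ℂ
        - ‖DstarL2 F n K c₀ U₀ (toL2 F K c₀ X) - RS F n K h c₀ cB U₀ (DstarL2 F n K c₀ U₀ (toL2 F K c₀ X))‖ ^ 2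
        + a * ‖Qk F n K h c₀ cB U₀ (toL2 F K c₀ X)‖ ^ 2 := by
  have hl := (abs_le.mp hloc).1
  have hq : 0 ≤ a * ‖Qk F n K h c₀ cB U₀ (toL2 F K c₀ X)‖ ^ 2 := by positivity
  linarith

/-- ★★ **THE REMAINDER IS BOUNDED ABOVE IN FORM**: with `‖Q_kv‖ ≤ C_Q‖v‖` (routeR-w4 ✓`sum_normSq_entries_QTwS_le` class: `C_Q² = 36(cB∕c₀)ℓ⁻³`, so `a·C_Q² = 36a₀` at the pins),
`re⟪v, toL2(η⁻²(Δ′₁−𝒦)X)⟫ − ‖D*v − R_SD*v‖² + a‖Q_kv‖² ≤ (C_loc + a·C_Q²)‖v‖²`. [cite: Balaban1985Variational, (134)–(136) p.298; Balaban1985BackgroundPropagators, (3.15) p.393] -/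
theorem re_remainder_le (U₀ : GaugeField (F.P K) 0 (Matrix.specialUnitaryGroup (Fin 2) ℂ)) (X : PBond (F.P K) 0 → Matrix (Fin 2) (Fin 2) ℂ)
    (ha : 0 ≤ a) {Cloc CQ : ℝ}
    (hloc : |RCLike.re ⟪toL2 F K c₀ X, toL2 F K c₀ (fun b : PBond (F.P K) 0 => (eta F n K)⁻¹ • (eta F n K)⁻¹ •
            (deltaPrimeOp (torusT (F.P K) 0) (fun μ x => bgUnits F K U₀ ⟨x, μ⟩) 1 (formComp X) b.dir b.src
              - curvOp (torusT (F.P K) 0) (fun μ x => bgUnits F K U₀ ⟨x, μ⟩) (formComp X) b.dir b.src))⟫_ℂ| ≤ Cloc * ‖toL2 F K c₀ X‖ ^ 2)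
    (hQ : ‖Qk F n K h c₀ cB U₀ (toL2 F K c₀ X)‖ ≤ CQ * ‖toL2 F K c₀ X‖) :
    RCLike.re ⟪toL2 F K c₀ X, toL2 F K c₀ (fun b : PBond (F.P K) 0 => (eta F n K)⁻¹ • (eta F n K)⁻¹ •
            (deltaPrimeOp (torusT (F.P K) 0) (fun μ x => bgUnits F K U₀ ⟨x, μ⟩) 1 (formComp X) b.dir b.src
              - curvOp (torusT (F.P K) 0) (fun μ x => bgUnits F K U₀ ⟨x, μ⟩) (formComp X) b.dir b.src))⟫_ℂ
        - ‖DstarL2 F n K c₀ U₀ (toL2 F K c₀ X) - RS F n K h c₀ cB U₀ (DstarL2 F n K c₀ U₀ (toL2 F K c₀ X))‖ ^ 2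
        + a * ‖Qk F n K h c₀ cB U₀ (toL2 F K c₀ X)‖ ^ 2
      ≤ (Cloc + a * CQ ^ 2) * ‖toL2 F K c₀ X‖ ^ 2 := by
  have hl := (abs_le.mp hloc).2
  have hq : a * ‖Qk F n K h c₀ cB U₀ (toL2 F K c₀ X)‖ ^ 2 ≤ a * (CQ * ‖toL2 F K c₀ X‖) ^ 2 :=
    mul_le_mul_of_nonneg_left (pow_le_pow_left₀ (norm_nonneg _) hQ 2) ha
  have hp : 0 ≤ ‖DstarL2 F n K c₀ U₀ (toL2 F K c₀ X) - RS F n K h c₀ cB U₀ (DstarL2 F n K c₀ U₀ (toL2 F K c₀ X))‖ ^ 2 := sq_nonneg _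
  nlinarith

end Summit.QuantumFields.YangMills.Theorems.Prop7OneFormGarding

end
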